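import Literature.AlgebraicGeometry.Motives.GrassmannianUniversalQuotient
import Literature.AlgebraicGeometry.Motives.GrassmannianChartTautologicalQuotient
import Mathlib.RingTheory.LocalProperties.Submodule
import HarnessLib

/-!
# The quotient `𝒬_x` of a point `x ∈ Gr(T)` is classified by `x`

Sequel to ★ `Motives/GrassmannianUniversalQuotient` (the rank-`k` quotient `π_x : 𝒪_T^{(J)} ↠ 𝒬_x` glued from chart
data `D : ChartData b x ι` of a point `x ∈ Gr_k(M)(T)`) and ★ `Motives/GrassmannianChartTautologicalQuotient` (chart
side). We identify the kernels of the sections maps `θ_V : Γ(T, V) ⊗ M → Γ(𝒬_x, V)`, `r ⊗ b_j ↦ r • q_j|_V`: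

* §1 on an affine open `V ⊆ U_a` inside a chart, `ker θ_V = x|_V` (`evalAffine V x`) and `θ_V` is onto — the
  tautological relation of ★ `ker_sectionsMap_eq_evalAffine`, fed by the frame expansion
  ★ `ChartData.map_quotientSection_eq_sum`;
* §2 **`ker θ_V = x|_V` on EVERY affine open `V ⊆ T`** (`ker_sectionsMap_quotientSection`): both sides localise
  (★ `localized'_ker_sectionsMap`, ★ `map_toSubmodule_eq_localized'`) and agree on the basic opens `D(r) ⊆ V` lying in
  a chart, which cover `V`; a submodule is determined by its localisations at a generating family
  (Mathlib `Submodule.eq_of_isLocalized'_span`, [GortzWedhorn2020, Thm. 7.12 with Cor. 7.17]);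
* §3 **the classifying morphism of `(𝒬_x, (q_j))` is the morphism classified by `x`**: the unique
  `f : T ⟶ grassmannianScheme M k` with `evalAffine V (pointsEquiv f) = ker θ_V` on all affine `V` (the universal
  property in the currency of ★ `existsUnique_hom_ker_sectionsMap`) is `(pointsEquiv M k T).symm x`
  ([GortzWedhorn2020, (8.4) (pp. 213–215)]: `Grass_k(M)` represents the rank-`k` quotients of `𝒪 ⊗ M`). For the
  universal point of `grassmannianScheme M k` this says that the universal quotient is classified by the identity.

Everything is proved; no named facts.

## References

* U. Görtz, T. Wedhorn, *Algebraic Geometry I*, 2nd ed. (2020), (8.4) pp. 213–215; Thm. 7.12 (p. 185) with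
  Cor. 7.17 (p. 188). [GortzWedhorn2020]
* The Stacks Project, Tag 089R (Grassmannian functor), Tag 00EO (local-global for modules). [StacksProject]
-/

noncomputable section

-- Mathlib's `Scheme.Modules` section API is stated across semireducible wrappers (as in Mathlib's own files).
set_option backward.isDefEq.respectTransparency false

universe u

open CategoryTheory Opposite TensorProduct TopologicalSpace AlgebraicGeometry

namespace Literature.AlgebraicGeometry.Motives.Grassmannian

open Literature.AlgebraicGeometry.Modules

namespace ChartData

variable {M : Type u} [AddCommGroup M] {k : ℕ} {J : Type u} {b : Module.Basis J ℤ M} {T : Scheme.{u}}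
  {x : (grassmannianSheaf M k).obj.obj (op T)} {ι : Type u} (D : ChartData b x ι)

/-! ## §1 On the affine opens inside a chart -/

/-- **Chart-local kernel identity**: on an affine open `V ⊆ U_a`, `ker (θ_V : Γ(T, V) ⊗ M → Γ(𝒬_x, V)) = x|_V`
(★ `ker_sectionsMap_eq_evalAffine` with the frame `quotientFrame a`, `σ := Equiv.ulift` and the frame expansion
★ `map_quotientSection_eq_sum`). [cite: GortzWedhorn2020, (8.4) (pp. 213–215)] [cite: StacksProject, Tag 089R] -/
theorem ker_sectionsMap_quotientSection_of_le (a : ι) {V : T.Opens} (hV : IsAffineOpen V) (ha : V ≤ D.U a) :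
    LinearMap.ker (sectionsMap b D.quotientModule D.quotientSection V) = (evalAffine hV x).toSubmodule :=
  ker_sectionsMap_eq_evalAffine b D.quotientModule D.quotientSection Equiv.ulift (D.quotientFrame a) (homOfLE ha) hV
    x (⇑b ∘ D.frame a) (D.evalAffine_mem_chart hV ha) fun j => D.map_quotientSection_eq_sum j a hV ha

/-- **Chart-local surjectivity**: on an affine open `V ⊆ U_a` the sections map `θ_V` is onto
(★ `sectionsMap_surjective_of_tautological`). [cite: GortzWedhorn2020, (8.4) (pp. 213–215)] -/
theorem sectionsMap_quotientSection_surjective_of_le (a : ι) {V : T.Opens} (hV : IsAffineOpen V)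
    (ha : V ≤ D.U a) : Function.Surjective (sectionsMap b D.quotientModule D.quotientSection V) :=
  sectionsMap_surjective_of_tautological b D.quotientModule D.quotientSection Equiv.ulift (D.quotientFrame a)
    (homOfLE ha) hV x (⇑b ∘ D.frame a) (D.evalAffine_mem_chart hV ha) fun j => D.map_quotientSection_eq_sum j a hV ha

/-! ## §2 On every affine open -/

/-- The sections of an affine open `V` whose basic open lies in a chart generate the unit ideal (their basic opens
cover `V` when the charts cover `T`). [cite: GortzWedhorn2020, Thm. 7.12 (p. 185) with Cor. 7.17 (p. 188)] -/
theorem span_setOf_basicOpen_le_eq_top (hcov : ∀ t : T, ∃ a, t ∈ D.U a) {V : T.Opens} (hV : IsAffineOpen V) :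
    Ideal.span {r : Γ(T, V) | ∃ a, T.basicOpen r ≤ D.U a} = ⊤ := by
  rw [← hV.self_le_iSup_basicOpen_iff]
  intro t ht
  obtain ⟨a, hta⟩ := hcov t
  obtain ⟨r, hrle, htr⟩ := hV.exists_basicOpen_le (V := V ⊓ D.U a) ⟨t, ht, hta⟩ ht
  exact Opens.mem_iSup.mpr ⟨⟨r, a, hrle.trans inf_le_right⟩, htr⟩

/-- **KERNEL IDENTITY ON EVERY AFFINE OPEN**: when the charts cover `T`, `ker (θ_V : Γ(T, V) ⊗ M → Γ(𝒬_x, V)) = x|_V`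
for every affine open `V ⊆ T`. Both sides localise to the corresponding objects on a basic open `D(r) ⊆ V`
(★ `localized'_ker_sectionsMap`; ★ `map_toSubmodule_eq_localized'` with `evalAffine_of_le`), they agree on the `D(r)`
inside a chart (§1), and those `r` generate the unit ideal, so the submodules agree (Mathlib
`Submodule.eq_of_isLocalized'_span`). [cite: GortzWedhorn2020, (8.4) (pp. 213–215)]
[cite: StacksProject, Tag 00EO] -/
theorem ker_sectionsMap_quotientSection (hcov : ∀ t : T, ∃ a, t ∈ D.U a) {V : T.Opens} (hV : IsAffineOpen V) :
    LinearMap.ker (sectionsMap b D.quotientModule D.quotientSection V) = (evalAffine hV x).toSubmodule := by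
  set s : Set Γ(T, V) := {r : Γ(T, V) | ∃ a, T.basicOpen r ≤ D.U a} with hs
  haveI : ∀ r : s, IsLocalization.Away (r.1 : Γ(T, V)) Γ(T, T.basicOpen (r.1 : Γ(T, V))) :=
    fun r => hV.isLocalization_basicOpen r.1
  have hQ : IsAffineLocalizing D.quotientModule :=
    isAffineLocalizing_of_isFiniteLocallyFree (D.cocycle.isFiniteLocallyFree_glued hcov)
  refine Submodule.eq_of_isLocalized'_span s (D.span_setOf_basicOpen_le_eq_top hcov hV)
    (fun r => Γ(T, T.basicOpen (r.1 : Γ(T, V)))) (fun r => Γ(T, T.basicOpen (r.1 : Γ(T, V))) ⊗[ℤ] M)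
    (fun r => AlgebraTensorModule.rTensor ℤ M (Algebra.linearMap Γ(T, V) Γ(T, T.basicOpen (r.1 : Γ(T, V)))))
    fun r => ?_
  obtain ⟨a, ha⟩ := r.2
  have hφ : (T.presheaf.map (homOfLE (T.basicOpen_le (r.1 : Γ(T, V)))).op).hom.toIntAlgHom =
      IsScalarTower.toAlgHom ℤ Γ(T, V) Γ(T, T.basicOpen (r.1 : Γ(T, V))) := AlgHom.ext fun _ => rfl
  rw [localized'_ker_sectionsMap b D.quotientModule D.quotientSection hV r.1 hQ,
    D.ker_sectionsMap_quotientSection_of_le a (hV.basicOpen r.1) ha,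
    evalAffine_of_le hV (hV.basicOpen r.1) (T.basicOpen_le r.1) x, hφ,
    map_toSubmodule_eq_localized' (.powers (r.1 : Γ(T, V)))]

/-! ## §3 The classifying morphism of `𝒬_x` is the morphism classified by `x` -/

variable (M k) [(grassmannianSheaf M k).obj.IsRepresentable]

/-- The morphism `T ⟶ grassmannianScheme M k` classified by `x` induces `ker θ_V` on every affine open `V`.
[cite: GortzWedhorn2020, (8.4) (pp. 213–215)] -/
theorem evalAffine_pointsEquiv_symm (hcov : ∀ t : T, ∃ a, t ∈ D.U a) (V : T.affineOpens) :
    (evalAffine V.2 (pointsEquiv M k T ((pointsEquiv M k T).symm x))).toSubmodule =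
      LinearMap.ker (sectionsMap b D.quotientModule D.quotientSection V) := by
  rw [Equiv.apply_symm_apply, D.ker_sectionsMap_quotientSection hcov V.2]

/-- **A morphism inducing the quotients `Γ(𝒬_x, V)` of `Γ(T, V) ⊗ M` on the affine opens is the morphism classified
by `x`** (★ `hom_ext_of_evalAffine`). [cite: GortzWedhorn2020, (8.4) (pp. 213–215)] [cite: StacksProject, Tag 089R] -/
theorem eq_pointsEquiv_symm_of_evalAffine_eq_ker (hcov : ∀ t : T, ∃ a, t ∈ D.U a)
    {f : T ⟶ grassmannianScheme M k}
    (hf : ∀ V : T.affineOpens, (evalAffine V.2 (pointsEquiv M k T f)).toSubmodule =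
      LinearMap.ker (sectionsMap b D.quotientModule D.quotientSection V)) :
    f = (pointsEquiv M k T).symm x := by
  refine hom_ext_of_evalAffine M k fun V hV => ?_
  ext : 1
  rw [hf ⟨V, hV⟩, D.evalAffine_pointsEquiv_symm M k hcov ⟨V, hV⟩]

/-- **THE QUOTIENT `𝒬_x` IS CLASSIFIED BY `x`.** For chart data `D` of `x ∈ Gr_k(M)(T)` whose charts cover `T`, there
is a unique `f : T ⟶ grassmannianScheme M k` with `evalAffine V (pointsEquiv f) = ker (Γ(T, V) ⊗ M → Γ(𝒬_x, V))` on
every affine open `V` — the shape of ★ `existsUnique_hom_ker_sectionsMap` — namely the morphism classified by `x`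
(`eq_pointsEquiv_symm_of_evalAffine_eq_ker`). For `T = grassmannianScheme M k` and the universal point this is the
identity: the universal quotient is classified by `𝟙`. [cite: GortzWedhorn2020, (8.4) (pp. 213–215)]
[cite: StacksProject, Tag 089R] -/
theorem existsUnique_hom_evalAffine_eq_ker (hcov : ∀ t : T, ∃ a, t ∈ D.U a) :
    ∃! f : T ⟶ grassmannianScheme M k, ∀ V : T.affineOpens,
      (evalAffine V.2 (pointsEquiv M k T f)).toSubmodule =
        LinearMap.ker (sectionsMap b D.quotientModule D.quotientSection V) :=
  ⟨(pointsEquiv M k T).symm x, D.evalAffine_pointsEquiv_symm M k hcov,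
    fun _ hf => D.eq_pointsEquiv_symm_of_evalAffine_eq_ker M k hcov hf⟩

end ChartData

end Literature.AlgebraicGeometry.Motives.Grassmannian

end
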